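import Summits.MatrixMultiplication.OmegaCensus.DominoZpZpKit
import Summits.MatrixMultiplication.OmegaCensus.Z4Z4Characters
import HarnessLib

/-!
# `GL₂(𝔽_p)` basis equivalences and fibre-count bookkeeping for the `ℤ_p × ℤ_p` domino cells (generic in the prime `p`)

ω-census `pub-omega`, family (b3), seat pub-omega-group gen 20.  Framing: lottery ticket; floor = certified bounds/negative
ranges.  VALUE: infrastructure for `DominoZpZpCells.lean`; NOT progress on ω.

Explicit additive automorphisms `basisEquiv v₁ v₂` of `ZMod p × ZMod p` (`(x, y) ↦ x·v₁ + y·v₂`, inverse `D⁻¹·adj`) with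
`det_ne_zero_of_not_mul`, `exists_det_ne_zero` (so that any two independent occupied points can be moved to `(1,0)`, `(0,1)`),
the points `pt p p = (1,0)`, `pt p 1 = (0,1)`, and the transport of translated fibre counts `|X ∩ Φ⁻¹(u + Φ b)|` under sums,
homomorphisms and automorphisms.
-/

namespace Summit.MatrixMultiplication.OmegaCensus

open Finset

namespace ZpZpDomino

/-! ## Fibre-count bookkeeping -/

section Bridge

variable {A B C : Type*} [AddCommGroup A] [AddCommGroup B] [Fintype B] [DecidableEq B]
  [AddCommGroup C] [DecidableEq C]

/-- The translated fibre counts of `X` sum to `|X|`. [folklore] -/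
theorem sum_card_fibre_shift (Φ : A →+ B) (X : Finset A) (h : B) :
    ∑ u : B, (X.filter fun a => Φ a = u + h).card = X.card := by
  rw [card_eq_sum_card_fiberwise (f := fun a : A => Φ a - h) (s := X) (t := (univ : Finset B))
    (fun a _ => mem_coe.2 (mem_univ _))]
  refine sum_congr rfl fun u _ => ?_
  congr 1; ext a
  simp only [mem_filter, sub_eq_iff_eq_add]

/-- Translated fibre counts push forward along a homomorphism `π`. [folklore] -/
theorem sum_filter_card_fibre_shift (Φ : A →+ B) (π : B →+ C) (X : Finset A) (h : B) (v : C) :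
    ∑ u ∈ univ.filter (fun u : B => π u = v), (X.filter fun a => Φ a = u + h).card =
      (X.filter fun a => π (Φ a) = v + π h).card := by
  rw [card_fibre_comp_eq_sum Φ π X (v + π h)]
  refine Finset.sum_equiv (Equiv.addRight h) (fun u => ?_) (fun u _ => rfl)
  simp only [mem_filter, mem_univ, true_and, Equiv.coe_addRight, map_add, add_left_inj]

omit [Fintype B] in
/-- Changing `Φ` by an automorphism `g` transports translated fibre counts. [folklore] -/
theorem card_fibre_shift_comp_equiv (g : B ≃+ B) (Φ : A →+ B) (X : Finset A) (b : A) (u : B) :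
    (X.filter fun a => (g.toAddMonoidHom.comp Φ) a = g u + (g.toAddMonoidHom.comp Φ) b).card =
      (X.filter fun a => Φ a = u + Φ b).card := by
  refine congrArg Finset.card (Finset.filter_congr fun a _ => ?_)
  show g (Φ a) = g u + g (Φ b) ↔ _
  rw [← map_add g, g.injective.eq_iff]

end Bridge

/-! ## `GL₂(𝔽_p)`: explicit basis equivalences -/

section GL2

variable {p : ℕ} [Fact p.Prime]

/-- The map `(x, y) ↦ x·v₁ + y·v₂` on `ZMod p × ZMod p`. [folklore] -/
def basisMap (v₁ v₂ : ZMod p × ZMod p) : ZMod p × ZMod p →+ ZMod p × ZMod p where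
  toFun u := (u.1 * v₁.1 + u.2 * v₂.1, u.1 * v₁.2 + u.2 * v₂.2)
  map_zero' := by simp
  map_add' x y := by ext <;> simp only [Prod.fst_add, Prod.snd_add, Prod.mk_add_mk] <;> ring

/-- The inverse `u ↦ D⁻¹·adj(v₁,v₂)·u`. [folklore] -/
def basisInv (v₁ v₂ : ZMod p × ZMod p) (u : ZMod p × ZMod p) : ZMod p × ZMod p :=
  ((v₁.1 * v₂.2 - v₁.2 * v₂.1)⁻¹ * (v₂.2 * u.1 - v₂.1 * u.2),
    (v₁.1 * v₂.2 - v₁.2 * v₂.1)⁻¹ * (v₁.1 * u.2 - v₁.2 * u.1))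

/-- **Basis equivalence**: for `det(v₁, v₂) ≠ 0`, `(x, y) ↦ x·v₁ + y·v₂` is an additive automorphism of `ℤ_p²`.
[folklore] -/
def basisEquiv (v₁ v₂ : ZMod p × ZMod p) (hD : v₁.1 * v₂.2 - v₁.2 * v₂.1 ≠ 0) :
    ZMod p × ZMod p ≃+ ZMod p × ZMod p :=
  { basisMap v₁ v₂ with
    invFun := basisInv v₁ v₂
    left_inv := fun u => by
      have hi : (v₁.1 * v₂.2 - v₁.2 * v₂.1)⁻¹ * (v₁.1 * v₂.2 - v₁.2 * v₂.1) = 1 := inv_mul_cancel₀ hD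
      ext
      · simp only [basisMap, basisInv]
        linear_combination u.1 * hi
      · simp only [basisMap, basisInv]
        linear_combination u.2 * hi
    right_inv := fun u => by
      have hi : (v₁.1 * v₂.2 - v₁.2 * v₂.1)⁻¹ * (v₁.1 * v₂.2 - v₁.2 * v₂.1) = 1 := inv_mul_cancel₀ hD
      ext
      · simp only [basisMap, basisInv]
        linear_combination u.1 * hi
      · simp only [basisMap, basisInv]
        linear_combination u.2 * hi }

/-- `basisEquiv (1, 0) = v₁`. [folklore] -/
theorem basisEquiv_one_zero (v₁ v₂ : ZMod p × ZMod p) (hD : v₁.1 * v₂.2 - v₁.2 * v₂.1 ≠ 0) :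
    basisEquiv v₁ v₂ hD (1, 0) = v₁ := by
  ext <;> simp [basisEquiv, basisMap]

/-- `basisEquiv (0, 1) = v₂`. [folklore] -/
theorem basisEquiv_zero_one (v₁ v₂ : ZMod p × ZMod p) (hD : v₁.1 * v₂.2 - v₁.2 * v₂.1 ≠ 0) :
    basisEquiv v₁ v₂ hD (0, 1) = v₂ := by
  ext <;> simp [basisEquiv, basisMap]

/-- `basisEquiv (k, 0) = k·v₁`. [folklore] -/
theorem basisEquiv_axis (v₁ v₂ : ZMod p × ZMod p) (hD : v₁.1 * v₂.2 - v₁.2 * v₂.1 ≠ 0) (k : ZMod p) :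
    basisEquiv v₁ v₂ hD (k, 0) = (k * v₁.1, k * v₁.2) := by
  ext <;> simp [basisEquiv, basisMap]

/-- A non-zero vector and a non-multiple have non-zero determinant. [folklore] -/
theorem det_ne_zero_of_not_mul (v₁ v₂ : ZMod p × ZMod p) (h₁ : v₁ ≠ 0)
    (h₂ : ∀ k : ZMod p, v₂ ≠ (k * v₁.1, k * v₁.2)) : v₁.1 * v₂.2 - v₁.2 * v₂.1 ≠ 0 := by
  intro hD
  by_cases ha : v₁.1 = 0
  · have hb : v₁.2 ≠ 0 := fun hb => h₁ (Prod.ext ha hb)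
    have hi : v₁.2⁻¹ * v₁.2 = 1 := inv_mul_cancel₀ hb
    refine h₂ (v₂.2 * v₁.2⁻¹) (Prod.ext ?_ ?_)
    · simp only
      rw [ha] at hD ⊢
      linear_combination (-v₁.2⁻¹) * hD + (-v₂.1) * hi
    · simp only
      linear_combination (-v₂.2) * hi
  · have hi : v₁.1⁻¹ * v₁.1 = 1 := inv_mul_cancel₀ ha
    refine h₂ (v₂.1 * v₁.1⁻¹) (Prod.ext ?_ ?_)
    · simp only
      linear_combination (-v₂.1) * hi
    · simp only
      linear_combination v₁.1⁻¹ * hD + (-v₂.2) * hi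

/-- Every non-zero vector has a complement. [folklore] -/
theorem exists_det_ne_zero (v₁ : ZMod p × ZMod p) (h₁ : v₁ ≠ 0) :
    ∃ v₂ : ZMod p × ZMod p, v₁.1 * v₂.2 - v₁.2 * v₂.1 ≠ 0 := by
  by_cases ha : v₁.1 = 0
  · have hb : v₁.2 ≠ 0 := fun hb => h₁ (Prod.ext ha hb)
    exact ⟨(1, 0), by simpa [ha] using hb⟩
  · exact ⟨(0, 1), by simpa using ha⟩

/-- `pt p p = (1, 0)`. [folklore] -/
theorem pt_self : pt p p = (1, 0) := by
  have hp : 0 < p := (Fact.out : p.Prime).pos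
  simp [pt, Nat.div_self hp, Nat.mod_self]

/-- `pt p 1 = (0, 1)`. [folklore] -/
theorem pt_one : pt p 1 = (0, 1) := by
  have hp : 1 < p := (Fact.out : p.Prime).one_lt
  simp [pt, Nat.div_eq_of_lt hp, Nat.mod_eq_of_lt hp]

/-- Off the axis `{u₂ = 0}` the second coordinate of `pt p i` is non-zero. [folklore] -/
theorem pt_snd_ne_zero {i : ℕ} (hi : i % p ≠ 0) : (pt p i).2 ≠ 0 := by
  have hp : 0 < p := (Fact.out : p.Prime).pos
  simp only [pt, ne_eq, ZMod.natCast_eq_zero_iff]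
  exact fun h => hi (Nat.eq_zero_of_dvd_of_lt h (Nat.mod_lt i hp))

/-- `pt p i ≠ 0` for `0 < i < p²`. [folklore] -/
theorem pt_ne_zero {i : ℕ} (hi : i < p * p) (hi0 : i ≠ 0) : pt p i ≠ 0 := by
  have hp : 0 < p := (Fact.out : p.Prime).pos
  intro h
  simp only [pt, Prod.ext_iff, Prod.fst_zero, Prod.snd_zero, ZMod.natCast_eq_zero_iff] at h
  have h1 : i / p = 0 := Nat.eq_zero_of_dvd_of_lt h.1 (Nat.div_lt_of_lt_mul hi)
  have h2 : i % p = 0 := Nat.eq_zero_of_dvd_of_lt h.2 (Nat.mod_lt i hp)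
  exact hi0 (by rw [← Nat.div_add_mod i p, h1, h2]; simp)

end GL2


end ZpZpDomino

end Summit.MatrixMultiplication.OmegaCensus
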